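import Summits.BirchSwinnertonDyer.Rank1Residual.AdditivePotMult.MixedCongruentPartnerEPWGord
import Summits.BirchSwinnertonDyer.Rank1Residual.Additive.CongruentPartnerMainConjectureGordBSD
import HarnessLib

/-!
# Rank-`0` `BSD(E,p)` ENDS on X4 congruent pairs of EITHER type at an odd `p`, lines discharged,
# partner input in RANK currency (cell `b2b-bsdres`, team n1011, seat p07 (gen 5), OWNERS row
# T-E3d-MIX FILE 3; sequel of `MixedCongruentPartnerEPW[Gord].lean`, of n1011-p10's
# `CongruentPartnerMainConjectureGordBSD` and of p07-g3's `PotMultBudgetRankZeroEnds`)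

HONEST FRAMING (cell `b2b-bsdres`, run/shared/lean/b2b/bsd-rank1-residual/, verbatim in every
file): the goal of the cell is to DELETE the COMBINATION-SHAPED residual classes of the
Birch–Swinnerton-Dyer formula for ALL analytic-rank `≤ 1` elliptic curves over `ℚ` — "full BSD
formula for every rank `≤ 1` curve in class `C`" assembled STRICTLY from published theorems — so
that the rank-`≤ 1` remainder becomes exactly the CONSTRUCTION-SHAPED classes, which are TYPED
(missing-input `Prop`s), NOT attempted. This is not "finishing BSD". Team n1011 (RESIDUAL-MAP §I
N10 / N11 LOWER half on X4♯(G-ord, `e = 2`) / X4(M) rows with `ρ̄_{E,p}` onto and `r_an = 0`, every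
odd `p` incl. `3`): research route on CONSTRUCTION-SHAPED items; labels and marks UNCHANGED; nothing
booked — every statement below is PER PAIR modulo the named facts AND per-pair inputs outside the
kernel (the unit coefficient / first-unit-index record = CERTIFICATE-EVIDENCE, two-engine rule; the
congruence = census `TorsionIso` currency; `Σ₀`; the partner's rank); booking = director, per pair,
after countersign. Theorems only; NO definition; NO Literature fact minted. Named facts enter as
HYPOTHESES exactly as in the consumed rank-`0` ends, none dropped: `hK` (Kato 2004 Thm. 17.4 (3)),
`hEPW` (EPW 2006 Thms. 3.3.2 / 3.3.3 (2) + Lemma 5.1.5), `hmodD`, `hmod`, `hGZK`, `hDel98`/`hDel`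
(Delbourgo 1998 Prop. 4), `hDelX` ((M) exact form), `hDel` / `hDel3` (Delbourgo 2002 Theorem /
Hypothesis at `3`, (G-ord) ends), `hPal` (Pal 2012 Thm. 3.2, idle at `p ≡ 3 (mod 4)`), and with an
(M) member `hT40`/`hT41` (Silverman *ATAEC* V.3.1 / V.5.3 / V.5.4 = A40/A41). Debt 0.

## What

The rank-`0` `BSD(E,p)` ends of Route G take a typed budget `BudgetLeLambdaAt p W b` at the index `b`
of the unit-coefficient record (`ClassX4Gord.bsdp[_three]_rankZero_of_katoHalf_of_coeffCert_of_budget_of_nonAnomalous[_noPal]`,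
`ClassX4M.bsdp[_three]_rankZero_of_surj_of_katoHalf_of_firstUnitIndex_of_budget`). FILES 1–2 produce
that budget from a congruent partner of EITHER type with the lines, the line-matching and the partner
input discharged. Composed here:
* §1 X4♯(G-ord) ∩ `I₀*` ∧ surj ∧ `r_an = 0` ∧ ¬CM ∧ non-anomalous row, `p ≥ 5`: `BSD(E,p)` from the
  record at `E` + a congruent partner in X4♯(G-ord) ∩ `I₀*` (`…_of_gordPartner_…`) or in X4(M)
  (`…_of_multPartner_…`) with `ρ̄_{E₁,p}` onto and `rank E₁(ℚ) ≥ r₁`, `b ≤ r₁ + Σ_{w∈Σ₀}(δ₁ − δ)`;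
* §2 the same at `p = 3` (Delbourgo 2002 AT 3 = `mainTheorem_three`; NO Pal binder);
* §3 X4(M) ∧ surj ∧ `r_an = 0` row, every odd `p` and `p = 3`: `BSD(E,p)` from the record at `E` + a
  congruent partner in X4♯(G-ord) ∩ `I₀*` ∧ surj with `rank ≥ r₁` (`…_of_gordPartner_of_congr`).
Per pair the residual inputs are EXACTLY: ONE unit coefficient at `E`, a plain congruence, `Σ₀`, a
partner (either type) with `ρ̄` onto and enough rank — plus, on the (G-ord) row, the row bits ¬CM /
non-anomalous of the consumed end.

What is NOT claimed: anomalous (G-ord) rows; X3♯; `e ∈ {3,4,6}`; semistable partners; `r_an = 1`;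
`p = 2`. X4♯(G-ord) / X4(M) stay CONSTRUCTION-SHAPED; nothing booked; no number closes anything.

References: Emerton–Pollack–Weston, Invent. Math. 163 (2006) Thms. 3.3.2, 3.3.3, Lemma 5.1.5
[EmertonPollackWeston2006]; Kato, Astérisque 295 (2004) Thm. 17.4 (3) [Kato2004Asterisque];
D. Delbourgo, Compositio Math. 113 (1998) Prop. 4 [Delbourgo1998]; D. Delbourgo, J. Number Theory 95
(2002) Theorem, Hypothesis p. 39 [Delbourgo2002]; A. Pal (2012) Thm. 3.2 [Pal2012]; R. L. Miller,
LMS J. Comput. Math. 14 (2011) Def. 1.1 [Miller2011LMS]; J. H. Silverman, *ATAEC* V.5.3–5.4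
[SilvermanATAEC1994].
-/

set_option autoImplicit false

noncomputable section

open scoped Classical MatrixGroups ModularForm NumberField

open CongruenceSubgroup WeierstrassCurve NumberField IsDedekindDomain Field
  Literature.NumberTheory.EllipticCurves
  Literature.NumberTheory.EllipticCurves.ModularForms
  Literature.NumberTheory.EllipticCurves.Rank1Residual
  Literature.NumberTheory.EllipticCurves.Rank1Residual.Typed
  Literature.NumberTheory.EllipticCurves.GreenbergSelmer
  Literature.NumberTheory.EllipticCurves.Wuthrich2014
  Literature.NumberTheory.EllipticCurves.GreenbergVatsal2000
  Literature.NumberTheory.EllipticCurves.EmertonPollackWeston2006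
  Literature.NumberTheory.EllipticCurves.Delbourgo2002
  Literature.NumberTheory.GaloisRepresentations
  Summit.BirchSwinnertonDyer.Rank1Residual.X1.MuLambda
  Summit.BirchSwinnertonDyer.Rank1Residual.X11a
  Summit.BirchSwinnertonDyer.Rank1Residual.Iwasawa

open Summit.BirchSwinnertonDyer.Rank1Residual.X1.CongruenceTransfer (TorsionIso CongruentLambdaShift)

/-! ### §1 X4♯(G-ord) ∩ `I₀*` ∧ surj row, `p ≥ 5`, `r_an = 0`: `BSD(E,p)` from the record + a partner -/

namespace Summit.BirchSwinnertonDyer.Rank1Residual.Additive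

open Summit.BirchSwinnertonDyer.Rank1Residual.AdditivePotMult
open Summit.BirchSwinnertonDyer.Rank1Residual.Additive.CensusQ6

section GordRow

variable {W W₁ : WeierstrassCurve ℚ} [W.IsElliptic] [W.IsGloballyMinimal] [W₁.IsElliptic]
  [W₁.IsGloballyMinimal] {p : ℕ} [hp : Fact p.Prime]

/-- **X4♯(G-ord) ∩ `I₀*` ∩ {`ρ̄` onto}, `p ≥ 5`, `r_an = 0`, non-CM, non-anomalous: `BSD(E,p)` from the
named facts + ONE unit coefficient at `E` at index `b` + a CONGRUENT PARTNER in X4♯(G-ord) ∩ `I₀*`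
with `ρ̄_{E₁,p}` onto and `rank E₁(ℚ) ≥ r₁`, `b ≤ r₁ + Σ_{w∈Σ₀} (δ(E₁,w) − δ(E,w))`** — n1011-p10's
`ClassX4Gord.bsdp_rankZero_of_katoHalf_of_coeffCert_of_budget_of_nonAnomalous` with `hbud :=` FILE 2
`ClassX4Gord.budgetLeLambdaAt_of_epw_of_gordPartner_of_congr`. PER PAIR; nothing booked.
[cite: Delbourgo2002, Theorem (A), (B) (p. 40)] [cite: Kato2004Asterisque, Thm. 17.4 (3) (p. 273)]
[cite: EmertonPollackWeston2006, Thm. 3.3.2, Thm. 3.3.3 (2) (arXiv:math/0404484 p. 19), Lemma 5.1.5 (p. 30)]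
[cite: Delbourgo1998, Prop. 4 (p. 144)] [cite: Miller2011LMS, §1 and Def. 1.1] -/
theorem ClassX4Gord.bsdp_rankZero_of_katoHalf_of_coeffCert_of_epw_of_gordPartner_of_nonAnomalous
    (hK : Wuthrich2014.kato_halfEigenCharIdeal_dvd_cyclotomicPrime_of_surjective)
    (hEPW : muLambdaAlg_transfer_of_torsionIso_potOrd)
    (hPal : Pal2012.thm32_sqrt_mul_realPeriodRat_twist_eq_of_prime_one_mod_four)
    (hDel98 : Delbourgo1998.prop4_rankZero_pow_dvd_constantCoeff) (hDel : Delbourgo2002.mainTheorem)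
    (hGZK : rank_eq_analyticRank_of_analyticRank_le_one) (hmod : hasEntireLFunction_rat)
    (hmodD : nonempty_modularParametrizationData)
    (hX : ClassX4Gord W p) (hcm : ¬ W.HasCM) (hp5 : 5 ≤ p) (he : semistabilityIndex W p = 2)
    (hsurj : Surj W p) (hr : W.analyticRank = 0) {b : ℕ} (hcert : BranchUnitCoeffAt W p b)
    (hna : ReductionNonAnomalous W p)
    (hX₁ : ClassX4Gord W₁ p) (he₁ : semistabilityIndex W₁ p = 2) (hsurj₁ : Surj W₁ p) {r₁ : ℕ}
    (hr₁ : r₁ ≤ W₁.mordellWeilRank) (hT : TorsionIso W W₁ p)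
    (S₀ : Finset (HeightOneSpectrum (𝓞 ℚ))) (hS₀ : ∀ w ∈ S₀, ((p : ℕ) : 𝓞 ℚ) ∉ w.asIdeal)
    (hS : ∀ w : HeightOneSpectrum (𝓞 ℚ), w ∉ S₀ → ((p : ℕ) : 𝓞 ℚ) ∉ w.asIdeal →
      W.HasGoodReductionAt w)
    (hS₁ : ∀ w : HeightOneSpectrum (𝓞 ℚ), w ∉ S₀ → ((p : ℕ) : 𝓞 ℚ) ∉ w.asIdeal →
      W₁.HasGoodReductionAt w)
    (hb : (b : ℤ) ≤ r₁ + ∑ w ∈ S₀, ((delta W₁ p w : ℤ) - (delta W p w : ℤ))) : BSDp W p :=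
  hX.bsdp_rankZero_of_katoHalf_of_coeffCert_of_budget_of_nonAnomalous hK hPal hDel98 hDel hGZK hmod
    hmodD hcm hp5 he hsurj hr hcert
    (hX.budgetLeLambdaAt_of_epw_of_gordPartner_of_congr hEPW hK hmodD he hX₁ he₁ hsurj₁ hr₁ hT S₀ hS₀
      hS hS₁ hb) hna

/-- **X4♯(G-ord) ∩ `I₀*` ∩ {`ρ̄` onto}, `p ≥ 5`, `r_an = 0`, non-CM, non-anomalous: `BSD(E,p)` from the
named facts + ONE unit coefficient at `E` at index `b` + a CONGRUENT PARTNER in X4(M) with `ρ̄_{E₁,p}`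
onto and `rank E₁(ℚ) ≥ r₁` (plain `Γ_ℚ`-equivariant `E[p] ≃+ E₁[p]`), `b ≤ r₁ + Σ_{w∈Σ₀} (δ₁ − δ)`**
— `hbud :=` FILE 2 `ClassX4Gord.budgetLeLambdaAt_of_epw_of_multPartner_of_congr` (mod A40/A41).
PER PAIR; nothing booked. [cite: Delbourgo2002, Theorem (A), (B) (p. 40)]
[cite: Kato2004Asterisque, Thm. 17.4 (3) (p. 273)] [cite: EmertonPollackWeston2006, Thm. 3.3.2, Thm. 3.3.3 (2) (arXiv:math/0404484 p. 19), Lemma 5.1.5 (p. 30)]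
[cite: Delbourgo1998, Prop. 4 (p. 144)] [cite: Miller2011LMS, §1 and Def. 1.1] [cite: SilvermanATAEC1994, Ch. V Thm. 5.3, Cor. 5.4] -/
theorem ClassX4Gord.bsdp_rankZero_of_katoHalf_of_coeffCert_of_epw_of_multPartner_of_nonAnomalous
    (hK : Wuthrich2014.kato_halfEigenCharIdeal_dvd_cyclotomicPrime_of_surjective)
    (hEPW : muLambdaAlg_transfer_of_torsionIso_potOrd)
    (hPal : Pal2012.thm32_sqrt_mul_realPeriodRat_twist_eq_of_prime_one_mod_four)
    (hDel98 : Delbourgo1998.prop4_rankZero_pow_dvd_constantCoeff) (hDel : Delbourgo2002.mainTheorem)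
    (hGZK : rank_eq_analyticRank_of_analyticRank_le_one) (hmod : hasEntireLFunction_rat)
    (hmodD : nonempty_modularParametrizationData)
    (hT40 : Silverman1994_thmV53_tateUniformisation.{0})
    (hT41 : Silverman1994_thmV53_corV54_tateUniformisation.{0})
    (hX : ClassX4Gord W p) (hcm : ¬ W.HasCM) (hp5 : 5 ≤ p) (he : semistabilityIndex W p = 2)
    (hsurj : Surj W p) (hr : W.analyticRank = 0) {b : ℕ} (hcert : BranchUnitCoeffAt W p b)
    (hna : ReductionNonAnomalous W p)
    (hX₁ : ClassX4M W₁ p) (hsurj₁ : Surj W₁ p) {r₁ : ℕ} (hr₁ : r₁ ≤ W₁.mordellWeilRank)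
    (hcong : ∃ e : geomTorsion W (p : ℤ) ≃+ geomTorsion W₁ (p : ℤ),
      ∀ (σ : absoluteGaloisGroup ℚ) (P : geomTorsion W (p : ℤ)), e (σ • P) = σ • e P)
    (S₀ : Finset (HeightOneSpectrum (𝓞 ℚ))) (hS₀ : ∀ w ∈ S₀, ((p : ℕ) : 𝓞 ℚ) ∉ w.asIdeal)
    (hS : ∀ w : HeightOneSpectrum (𝓞 ℚ), w ∉ S₀ → ((p : ℕ) : 𝓞 ℚ) ∉ w.asIdeal →
      W.HasGoodReductionAt w)
    (hS₁ : ∀ w : HeightOneSpectrum (𝓞 ℚ), w ∉ S₀ → ((p : ℕ) : 𝓞 ℚ) ∉ w.asIdeal →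
      W₁.HasGoodReductionAt w)
    (hb : (b : ℤ) ≤ r₁ + ∑ w ∈ S₀, ((delta W₁ p w : ℤ) - (delta W p w : ℤ))) : BSDp W p :=
  hX.bsdp_rankZero_of_katoHalf_of_coeffCert_of_budget_of_nonAnomalous hK hPal hDel98 hDel hGZK hmod
    hmodD hcm hp5 he hsurj hr hcert
    (hX.budgetLeLambdaAt_of_epw_of_multPartner_of_congr hEPW hK hmodD hT40 hT41 he hX₁ hsurj₁ hr₁ hcong
      S₀ hS₀ hS hS₁ hb) hna

end GordRow

/-! ### §2 The same at `p = 3` (Delbourgo 2002 AT 3; NO Pal binder) -/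

section GordRowThree

variable {W W₁ : WeierstrassCurve ℚ} [W.IsElliptic] [W.IsGloballyMinimal] [W₁.IsElliptic]
  [W₁.IsGloballyMinimal]

/-- **X4♯(G-ord) at `3` ∧ surj(3), `r_an = 0`, non-CM, non-anomalous: `BSD(E,3)` from the named facts
(Kato half, EPW, Delbourgo 1998 Prop. 4, Delbourgo 2002 AT 3 = `mainTheorem_three`, GZK, modularity)
+ ONE 3-adic unit coefficient at `E` at index `b` + a CONGRUENT PARTNER in X4♯(G-ord) at `3` with
`ρ̄_{E₁,3}` onto and `rank E₁(ℚ) ≥ r₁`, `b ≤ r₁ + Σ_{w∈Σ₀} (δ₁ − δ)`; NO Pal binder** (`I₀*` is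
automatic at `3`: `semistabilityIndex_eq_two_of_typeG_three`). PER PAIR; nothing booked.
[cite: Delbourgo2002, Theorem (A), (B) (p. 40), Hypothesis (p. 39)] [cite: Kato2004Asterisque, Thm. 17.4 (3) (p. 273)]
[cite: EmertonPollackWeston2006, Thm. 3.3.3 (2) (arXiv:math/0404484 p. 19)] [cite: Delbourgo1998, Prop. 4 (p. 144)]
[cite: Miller2011LMS, §1 and Def. 1.1] -/
theorem ClassX4Gord.bsdp_three_rankZero_of_katoHalf_of_coeffCert_of_epw_of_gordPartner_of_nonAnomalous
    [Fact (Nat.Prime 3)]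
    (hK : Wuthrich2014.kato_halfEigenCharIdeal_dvd_cyclotomicPrime_of_surjective)
    (hEPW : muLambdaAlg_transfer_of_torsionIso_potOrd)
    (hDel98 : Delbourgo1998.prop4_rankZero_pow_dvd_constantCoeff)
    (hDel3 : Delbourgo2002.mainTheorem_three)
    (hGZK : rank_eq_analyticRank_of_analyticRank_le_one) (hmod : hasEntireLFunction_rat)
    (hmodD : nonempty_modularParametrizationData)
    (hX : ClassX4Gord W 3) (hcm : ¬ W.HasCM) (hsurj : Surj W 3) (hr : W.analyticRank = 0) {b : ℕ}
    (hcert : BranchUnitCoeffAt W 3 b) (hna : ReductionNonAnomalous W 3)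
    (hX₁ : ClassX4Gord W₁ 3) (hsurj₁ : Surj W₁ 3) {r₁ : ℕ} (hr₁ : r₁ ≤ W₁.mordellWeilRank)
    (hT : TorsionIso W W₁ 3)
    (S₀ : Finset (HeightOneSpectrum (𝓞 ℚ))) (hS₀ : ∀ w ∈ S₀, ((3 : ℕ) : 𝓞 ℚ) ∉ w.asIdeal)
    (hS : ∀ w : HeightOneSpectrum (𝓞 ℚ), w ∉ S₀ → ((3 : ℕ) : 𝓞 ℚ) ∉ w.asIdeal →
      W.HasGoodReductionAt w)
    (hS₁ : ∀ w : HeightOneSpectrum (𝓞 ℚ), w ∉ S₀ → ((3 : ℕ) : 𝓞 ℚ) ∉ w.asIdeal →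
      W₁.HasGoodReductionAt w)
    (hb : (b : ℤ) ≤ r₁ + ∑ w ∈ S₀, ((delta W₁ 3 w : ℤ) - (delta W 3 w : ℤ))) : BSDp W 3 :=
  have he : semistabilityIndex W 3 = 2 :=
    semistabilityIndex_eq_two_of_typeG_three W hX.typeGOrd.typeG hX.addv.2
  have he₁ : semistabilityIndex W₁ 3 = 2 :=
    semistabilityIndex_eq_two_of_typeG_three W₁ hX₁.typeGOrd.typeG hX₁.addv.2
  ClassX4Gord.bsdp_three_rankZero_of_katoHalf_of_coeffCert_of_budget_of_nonAnomalous_noPal hK hDel98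
    hDel3 hGZK hmod hmodD hX hcm hsurj hr hcert
    (hX.budgetLeLambdaAt_of_epw_of_gordPartner_of_congr hEPW hK hmodD he hX₁ he₁ hsurj₁ hr₁ hT S₀ hS₀
      hS hS₁ hb) hna

/-- **X4♯(G-ord) at `3` ∧ surj(3), `r_an = 0`, non-CM, non-anomalous: `BSD(E,3)` from the named facts
+ ONE 3-adic unit coefficient at `E` at index `b` + a CONGRUENT PARTNER in X4(M) at `3` with
`ρ̄_{E₁,3}` onto and `rank E₁(ℚ) ≥ r₁` (plain congruence `E[3] ≅ E₁[3]`), `b ≤ r₁ + Σ (δ₁ − δ)`; NO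
Pal binder; mod A40/A41.** PER PAIR; nothing booked.
[cite: Delbourgo2002, Theorem (A), (B) (p. 40), Hypothesis (p. 39)] [cite: Kato2004Asterisque, Thm. 17.4 (3) (p. 273)]
[cite: EmertonPollackWeston2006, Thm. 3.3.3 (2) (arXiv:math/0404484 p. 19)] [cite: Delbourgo1998, Prop. 4 (p. 144)]
[cite: Miller2011LMS, §1 and Def. 1.1] [cite: SilvermanATAEC1994, Ch. V Thm. 5.3, Cor. 5.4] -/
theorem ClassX4Gord.bsdp_three_rankZero_of_katoHalf_of_coeffCert_of_epw_of_multPartner_of_nonAnomalous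
    [Fact (Nat.Prime 3)]
    (hK : Wuthrich2014.kato_halfEigenCharIdeal_dvd_cyclotomicPrime_of_surjective)
    (hEPW : muLambdaAlg_transfer_of_torsionIso_potOrd)
    (hDel98 : Delbourgo1998.prop4_rankZero_pow_dvd_constantCoeff)
    (hDel3 : Delbourgo2002.mainTheorem_three)
    (hGZK : rank_eq_analyticRank_of_analyticRank_le_one) (hmod : hasEntireLFunction_rat)
    (hmodD : nonempty_modularParametrizationData)
    (hT40 : Silverman1994_thmV53_tateUniformisation.{0})
    (hT41 : Silverman1994_thmV53_corV54_tateUniformisation.{0})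
    (hX : ClassX4Gord W 3) (hcm : ¬ W.HasCM) (hsurj : Surj W 3) (hr : W.analyticRank = 0) {b : ℕ}
    (hcert : BranchUnitCoeffAt W 3 b) (hna : ReductionNonAnomalous W 3)
    (hX₁ : ClassX4M W₁ 3) (hsurj₁ : Surj W₁ 3) {r₁ : ℕ} (hr₁ : r₁ ≤ W₁.mordellWeilRank)
    (hcong : ∃ e : geomTorsion W ((3 : ℕ) : ℤ) ≃+ geomTorsion W₁ ((3 : ℕ) : ℤ),
      ∀ (σ : absoluteGaloisGroup ℚ) (P : geomTorsion W ((3 : ℕ) : ℤ)), e (σ • P) = σ • e P)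
    (S₀ : Finset (HeightOneSpectrum (𝓞 ℚ))) (hS₀ : ∀ w ∈ S₀, ((3 : ℕ) : 𝓞 ℚ) ∉ w.asIdeal)
    (hS : ∀ w : HeightOneSpectrum (𝓞 ℚ), w ∉ S₀ → ((3 : ℕ) : 𝓞 ℚ) ∉ w.asIdeal →
      W.HasGoodReductionAt w)
    (hS₁ : ∀ w : HeightOneSpectrum (𝓞 ℚ), w ∉ S₀ → ((3 : ℕ) : 𝓞 ℚ) ∉ w.asIdeal →
      W₁.HasGoodReductionAt w)
    (hb : (b : ℤ) ≤ r₁ + ∑ w ∈ S₀, ((delta W₁ 3 w : ℤ) - (delta W 3 w : ℤ))) : BSDp W 3 :=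
  have he : semistabilityIndex W 3 = 2 :=
    semistabilityIndex_eq_two_of_typeG_three W hX.typeGOrd.typeG hX.addv.2
  ClassX4Gord.bsdp_three_rankZero_of_katoHalf_of_coeffCert_of_budget_of_nonAnomalous_noPal hK hDel98
    hDel3 hGZK hmod hmodD hX hcm hsurj hr hcert
    (hX.budgetLeLambdaAt_of_epw_of_multPartner_of_congr hEPW hK hmodD hT40 hT41 he hX₁ hsurj₁ hr₁ hcong
      S₀ hS₀ hS hS₁ hb) hna

end GordRowThree

end Summit.BirchSwinnertonDyer.Rank1Residual.Additive

/-! ### §3 X4(M) ∧ surj row, every odd `p` and `p = 3`: `BSD(E,p)` from the record + a (G-ord) partner -/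

namespace Summit.BirchSwinnertonDyer.Rank1Residual.AdditivePotMult

open Summit.BirchSwinnertonDyer.Rank1Residual.Additive
open Summit.BirchSwinnertonDyer.Rank1Residual.Additive.CensusQ6

section MultRow

variable {W W₁ : WeierstrassCurve ℚ} [W.IsElliptic] [W.IsGloballyMinimal] [W₁.IsElliptic]
  [W₁.IsGloballyMinimal] {p : ℕ} [hp : Fact p.Prime]

/-- **X4(M) ∧ surj(p) ∧ `r_an = 0`, EVERY odd `p` (`p = 3` included): `BSD(E,p)` ⟸ the census record
at index `b` (parity of `(p−1)/2`) + a CONGRUENT PARTNER in X4♯(G-ord) ∩ `I₀*` with `ρ̄_{E₁,p}` onto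
and `rank E₁(ℚ) ≥ r₁` (plain `Γ_ℚ`-equivariant `E[p] ≃+ E₁[p]`), `Σ₀`, `b ≤ r₁ + Σ_{w∈Σ₀} (δ₁ − δ)`**
— p07-g3's `ClassX4M.bsdp_rankZero_of_surj_of_katoHalf_of_firstUnitIndex_of_budget` with `hbud :=`
FILE 1 `ClassX4M.budgetLeLambdaAt_of_epw_of_gordPartner_of_congr`. The (M)–(G-ord) twin of
`ClassX4M.bsdp_rankZero_of_surj_of_katoHalf_of_firstUnitIndex_of_epw_of_multPartner_of_congr`; the
per-pair residual inputs are the SAME list. PER PAIR; X4(M) stays CONSTRUCTION-SHAPED; nothing booked.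
[cite: Kato2004Asterisque, Thm. 17.4 (3) (p. 273)] [cite: EmertonPollackWeston2006, Thm. 3.3.2, Thm. 3.3.3 (2) (arXiv:math/0404484 p. 19), Lemma 5.1.5 (p. 30)]
[cite: Delbourgo1998, Prop. 4 (p. 144)] [cite: Pal2012, Thm. 3.2] [cite: Miller2011LMS, Def. 1.1]
[cite: SilvermanATAEC1994, Ch. V Thm. 5.3, Cor. 5.4] -/
theorem ClassX4M.bsdp_rankZero_of_surj_of_katoHalf_of_firstUnitIndex_of_epw_of_gordPartner_of_congr
    (hK : Wuthrich2014.kato_halfEigenCharIdeal_dvd_cyclotomicPrime_of_surjective)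
    (hEPW : muLambdaAlg_transfer_of_torsionIso_potOrd)
    (hDel : Delbourgo1998.prop4_rankZero_pow_dvd_constantCoeff)
    (hDelX : Delbourgo1998.prop4_rankZero_constantCoeff_eq_unit_mul_of_potMult)
    (hPal : Pal2012.thm32_sqrt_mul_realPeriodRat_twist_eq_of_prime_one_mod_four)
    (hGZK : rank_eq_analyticRank_of_analyticRank_le_one) (hmod : hasEntireLFunction_rat)
    (hmodD : nonempty_modularParametrizationData)
    (hT40 : Silverman1994_thmV53_tateUniformisation.{0})
    (hT41 : Silverman1994_thmV53_corV54_tateUniformisation.{0})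
    (hX : ClassX4M W p) (hsurj : Surj W p) (hr : W.analyticRank = 0) {b : ℕ}
    (hrec : (p % 4 = 1 → MultFirstUnitIndexAt W p b) ∧ (p % 4 = 3 → MultOddFirstUnitIndexAt W p b))
    (hX₁ : ClassX4Gord W₁ p) (he₁ : semistabilityIndex W₁ p = 2) (hsurj₁ : Surj W₁ p) {r₁ : ℕ}
    (hr₁ : r₁ ≤ W₁.mordellWeilRank)
    (hcong : ∃ e : geomTorsion W (p : ℤ) ≃+ geomTorsion W₁ (p : ℤ),
      ∀ (σ : absoluteGaloisGroup ℚ) (P : geomTorsion W (p : ℤ)), e (σ • P) = σ • e P)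
    (S₀ : Finset (HeightOneSpectrum (𝓞 ℚ))) (hS₀ : ∀ w ∈ S₀, ((p : ℕ) : 𝓞 ℚ) ∉ w.asIdeal)
    (hS : ∀ w : HeightOneSpectrum (𝓞 ℚ), w ∉ S₀ → ((p : ℕ) : 𝓞 ℚ) ∉ w.asIdeal →
      W.HasGoodReductionAt w)
    (hS₁ : ∀ w : HeightOneSpectrum (𝓞 ℚ), w ∉ S₀ → ((p : ℕ) : 𝓞 ℚ) ∉ w.asIdeal →
      W₁.HasGoodReductionAt w)
    (hb : (b : ℤ) ≤ r₁ + ∑ w ∈ S₀, ((delta W₁ p w : ℤ) - (delta W p w : ℤ))) : BSDp W p :=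
  hX.bsdp_rankZero_of_surj_of_katoHalf_of_firstUnitIndex_of_budget hK hDel hDelX hPal hGZK hmod hmodD
    hsurj hr hrec
    (hX.budgetLeLambdaAt_of_epw_of_gordPartner_of_congr hEPW hK hmodD hT40 hT41 hX₁ he₁ hsurj₁ hr₁ hcong
      S₀ hS₀ hS hS₁ hb)

/-- **`p = 3` specialisation (the N11 (M) rows of record; nothing closed by this statement):** X4(M) ∧
surj(3) ∧ `r_an = 0`, record `MultOddFirstUnitIndexAt W 3 b` (odd branch) + a congruent partner in
X4♯(G-ord) at `3` with `ρ̄_{E₁,3}` onto and `rank ≥ r₁`, `Σ₀`, `b ≤ r₁ + Σ (δ₁ − δ)` ⟹ `BSD(E,3)`.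
[cite: Kato2004Asterisque, Thm. 17.4 (3) (p. 273)] [cite: EmertonPollackWeston2006, Thm. 3.3.3 (2) (arXiv:math/0404484 p. 19)]
[cite: Delbourgo1998, Prop. 4 (p. 144)] [cite: Miller2011LMS, Def. 1.1] [cite: SilvermanATAEC1994, Ch. V Thm. 5.3, Cor. 5.4] -/
theorem ClassX4M.bsdp_three_rankZero_of_surj_of_katoHalf_of_firstUnitIndex_of_epw_of_gordPartner_of_congr
    [Fact (Nat.Prime 3)] {W W₁ : WeierstrassCurve ℚ} [W.IsElliptic] [W.IsGloballyMinimal]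
    [W₁.IsElliptic] [W₁.IsGloballyMinimal]
    (hK : Wuthrich2014.kato_halfEigenCharIdeal_dvd_cyclotomicPrime_of_surjective)
    (hEPW : muLambdaAlg_transfer_of_torsionIso_potOrd)
    (hDel : Delbourgo1998.prop4_rankZero_pow_dvd_constantCoeff)
    (hDelX : Delbourgo1998.prop4_rankZero_constantCoeff_eq_unit_mul_of_potMult)
    (hPal : Pal2012.thm32_sqrt_mul_realPeriodRat_twist_eq_of_prime_one_mod_four)
    (hGZK : rank_eq_analyticRank_of_analyticRank_le_one) (hmod : hasEntireLFunction_rat)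
    (hmodD : nonempty_modularParametrizationData)
    (hT40 : Silverman1994_thmV53_tateUniformisation.{0})
    (hT41 : Silverman1994_thmV53_corV54_tateUniformisation.{0})
    (hX : ClassX4M W 3) (hsurj : Surj W 3) (hr : W.analyticRank = 0) {b : ℕ}
    (hrec : MultOddFirstUnitIndexAt W 3 b)
    (hX₁ : ClassX4Gord W₁ 3) (hsurj₁ : Surj W₁ 3) {r₁ : ℕ} (hr₁ : r₁ ≤ W₁.mordellWeilRank)
    (hcong : ∃ e : geomTorsion W ((3 : ℕ) : ℤ) ≃+ geomTorsion W₁ ((3 : ℕ) : ℤ),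
      ∀ (σ : absoluteGaloisGroup ℚ) (P : geomTorsion W ((3 : ℕ) : ℤ)), e (σ • P) = σ • e P)
    (S₀ : Finset (HeightOneSpectrum (𝓞 ℚ))) (hS₀ : ∀ w ∈ S₀, ((3 : ℕ) : 𝓞 ℚ) ∉ w.asIdeal)
    (hS : ∀ w : HeightOneSpectrum (𝓞 ℚ), w ∉ S₀ → ((3 : ℕ) : 𝓞 ℚ) ∉ w.asIdeal →
      W.HasGoodReductionAt w)
    (hS₁ : ∀ w : HeightOneSpectrum (𝓞 ℚ), w ∉ S₀ → ((3 : ℕ) : 𝓞 ℚ) ∉ w.asIdeal →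
      W₁.HasGoodReductionAt w)
    (hb : (b : ℤ) ≤ r₁ + ∑ w ∈ S₀, ((delta W₁ 3 w : ℤ) - (delta W 3 w : ℤ))) : BSDp W 3 :=
  have he₁ : semistabilityIndex W₁ 3 = 2 :=
    semistabilityIndex_eq_two_of_typeG_three W₁ hX₁.typeGOrd.typeG hX₁.addv.2
  hX.bsdp_rankZero_of_surj_of_katoHalf_of_firstUnitIndex_of_epw_of_gordPartner_of_congr hK hEPW hDel
    hDelX hPal hGZK hmod hmodD hT40 hT41 hsurj hr ⟨fun h ↦ absurd h (by norm_num), fun _ ↦ hrec⟩ hX₁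
    he₁ hsurj₁ hr₁ hcong S₀ hS₀ hS hS₁ hb

end MultRow

end Summit.BirchSwinnertonDyer.Rank1Residual.AdditivePotMult

end
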